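import Literature.AlgebraicGeometry.Resolution.QuasiRegularSequences
import Mathlib.RingTheory.MvPolynomial.Homogeneous
import Mathlib.RingTheory.LocalRing.ResidueField.Basic
import Mathlib.RingTheory.Noetherian.Basic
import HarnessLib

/-!
# Crux `PatchingRelPerfect` (stmt-ResolutionOfSingularities-16161), chain W5.2 — F6 §1: every depth-two member has a
# TAYLOR PRESENTATION `I = (σP₀ˡ(x) + σP₁ˡ(x) + Gˡ)_l + (x_k^{d+2})_k` over a coefficient field

[OURS · L1 W5.2 · rung tool] res-L1-w52-plan-1 g7 GO 2026-08-27T08:35:38Z («`exists_taylor_presentation`»): for a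
local ring `S` with a coefficient field `σ : κ₀ → S` (`residue ∘ σ` bijective) and generators `x` of `𝔪`,

* `exists_form_sub_mem_pow_succ` — **Taylor step**: every `a ∈ 𝔪ⁿ` is `σP(x)` modulo `𝔪^{n+1}` for a FORM `P ∈ κ₀[T]` of
  degree `n` (`a = F(x)` for a form `F` over `S`, Mathlib `Ideal.mem_span_pow_iff_exists_isHomogeneous`; replace the
  coefficients by their `σ ∘ residue` representatives, the difference has coefficients in `𝔪` and evaluates into
  `𝔪 · 𝔪ⁿ`, tree `eval_mem_mul_span_pow`);
* `exists_forms_sub_mem_pow_add_two` — two steps: `a ∈ 𝔪^d` is `σP₀(x) + σP₁(x)` modulo `𝔪^{d+2}`, `deg P₀ = d`,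
  `deg P₁ = d + 1`;
* **`exists_taylor_presentation`** — for `S` moreover Noetherian, every ideal `I` with `I ≤ 𝔪^d` and `x_k^{d+2} ∈ I` for all
  `k` (the depth-two members at exponent `d`, `HasExceptionalDepth 2`) EQUALS
  `(σP₀ˡ(x) + σP₁ˡ(x) + Gˡ)_l + (x_k^{d+2})_k` for finitely many forms `P₀ˡ` (degree `d`), `P₁ˡ` (degree `d + 1`) and
  remainders `Gˡ ∈ 𝔪^{d+2}` — the input shape of res-D-pv-055's `taylorPackageTwo` (`…DepthTaylorInitial`).

Fact-free. Rung tool of OUR route; nothing here is a statement of the manuscript under review; AI-written, weaker than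
expert review.

## References
* I. S. Cohen, *On the structure and ideal theory of complete local rings*, TAMS 59 (1946), Thm. 9 (coefficient fields).
  [Cohen1946]
* H. Matsumura, *Commutative Ring Theory* (1986), Thm. 17.10, Thm. 29.4 (proof: expansion in a regular system of parameters
  with coefficients in a coefficient field). [Matsumura1987]
-/

-- `Summit.<Summit>.<Sub>.Theorems` with `Sub = Summit` (single-conjunct summit, D-0017)
set_option linter.dupNamespace false

noncomputable section

open Literature.AlgebraicGeometry.Resolution IsLocalRing

namespace Summit.ResolutionOfSingularities.ResolutionOfSingularities.Theorems

universe u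

namespace DepthTargets

variable {S : Type u} [CommRing S] [IsLocalRing S] {κ₀ : Type u} [Field κ₀] (σ : κ₀ →+* S)
  (hσ : Function.Bijective ⇑((IsLocalRing.residue S).comp σ)) {n : ℕ} (x : Fin n → S)
  (hx : Ideal.span (Set.range x) = IsLocalRing.maximalIdeal S)

include hσ hx in
/-- **Taylor step over a coefficient field**: every `a ∈ 𝔪ᵉ` is congruent modulo `𝔪^{e+1}` to `σP(x)` for a form
`P ∈ κ₀[T₀,…,T_{n-1}]` of degree `e`. [cite: Matsumura1987, Thm. 29.4 (proof)] [cite: Cohen1946, Thm. 9] -/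
theorem exists_form_sub_mem_pow_succ {e : ℕ} {a : S} (ha : a ∈ IsLocalRing.maximalIdeal S ^ e) :
    ∃ P : MvPolynomial (Fin n) κ₀, P ∈ MvPolynomial.homogeneousSubmodule (Fin n) κ₀ e ∧
      a - MvPolynomial.eval₂Hom σ x P ∈ IsLocalRing.maximalIdeal S ^ (e + 1) := by
  rw [← hx] at ha
  obtain ⟨F, hF, rfl⟩ := exists_isHomogeneous_of_mem_span_pow x e ha
  -- the coefficient map `τ = (residue ∘ σ)⁻¹ ∘ residue : S → κ₀`
  set eκ : κ₀ ≃+* IsLocalRing.ResidueField S := RingEquiv.ofBijective ((IsLocalRing.residue S).comp σ) hσ with heκ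
  set τ : S →+* κ₀ := eκ.symm.toRingHom.comp (IsLocalRing.residue S) with hτ
  have hστ : ∀ c : S, c - σ (τ c) ∈ IsLocalRing.maximalIdeal S := by
    intro c
    rw [← IsLocalRing.residue_eq_zero_iff, map_sub, sub_eq_zero]
    have h1 : (IsLocalRing.residue S) (σ (τ c)) = eκ (τ c) := rfl
    rw [h1, hτ, RingHom.comp_apply, RingEquiv.toRingHom_eq_coe, RingEquiv.coe_toRingHom, RingEquiv.apply_symm_apply]
  refine ⟨MvPolynomial.map τ F, (MvPolynomial.mem_homogeneousSubmodule _ _).mpr (hF.map τ), ?_⟩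
  -- `F - σ(τF)` is a form of degree `e` with coefficients in `𝔪`
  have hD : (F - MvPolynomial.map (σ.comp τ) F) ∈ Ideal.map MvPolynomial.C (IsLocalRing.maximalIdeal S) := by
    rw [MvPolynomial.mem_map_C_iff]
    intro mono
    rw [MvPolynomial.coeff_sub, MvPolynomial.coeff_map, RingHom.comp_apply]
    exact hστ _
  have hDhom : (F - MvPolynomial.map (σ.comp τ) F).IsHomogeneous e := hF.sub (hF.map _)
  have h := eval_mem_mul_span_pow x hDhom hD
  rw [hx, ← pow_succ'] at h
  have heval : MvPolynomial.eval₂Hom σ x (MvPolynomial.map τ F) = MvPolynomial.eval x (MvPolynomial.map (σ.comp τ) F) := by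
    rw [MvPolynomial.coe_eval₂Hom, MvPolynomial.eval₂_map, MvPolynomial.eval_map]
  rw [heval, ← map_sub]
  exact h

include hσ hx in
/-- **Two Taylor steps**: every `a ∈ 𝔪ᵈ` is `σP₀(x) + σP₁(x)` modulo `𝔪^{d+2}` with `P₀`, `P₁` forms of degrees `d`,
`d + 1` over the coefficient field. [cite: Matsumura1987, Thm. 29.4 (proof)] [cite: Cohen1946, Thm. 9] -/
theorem exists_forms_sub_mem_pow_add_two {d : ℕ} {a : S} (ha : a ∈ IsLocalRing.maximalIdeal S ^ d) :
    ∃ P₀ P₁ : MvPolynomial (Fin n) κ₀, P₀ ∈ MvPolynomial.homogeneousSubmodule (Fin n) κ₀ d ∧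
      P₁ ∈ MvPolynomial.homogeneousSubmodule (Fin n) κ₀ (d + 1) ∧
      a - MvPolynomial.eval₂Hom σ x P₀ - MvPolynomial.eval₂Hom σ x P₁ ∈ IsLocalRing.maximalIdeal S ^ (d + 2) := by
  obtain ⟨P₀, hP₀, h₀⟩ := exists_form_sub_mem_pow_succ σ hσ x hx ha
  obtain ⟨P₁, hP₁, h₁⟩ := exists_form_sub_mem_pow_succ σ hσ x hx h₀
  exact ⟨P₀, P₁, hP₀, hP₁, h₁⟩

include hσ hx in
/-- **EVERY DEPTH-TWO MEMBER HAS A TAYLOR PRESENTATION.** For `S` local Noetherian with a coefficient field `σ` and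
generators `x` of `𝔪`: an ideal `I ≤ 𝔪ᵈ` containing all `x_k^{d+2}` (`HasExceptionalDepth 2 x I` at exponent `d`) equals
`(σP₀ˡ(x) + σP₁ˡ(x) + Gˡ)_l + (x_k^{d+2})_k` for finitely many forms `P₀ˡ` of degree `d`, `P₁ˡ` of degree `d + 1` over
`κ₀` and remainders `Gˡ ∈ 𝔪^{d+2}` — the input shape of the Taylor package `taylorPackageTwo`.
[cite: Matsumura1987, Thm. 29.4 (proof)] [cite: Cohen1946, Thm. 9] -/
theorem exists_taylor_presentation [IsNoetherianRing S] {d : ℕ} (I : Ideal S)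
    (hI : I ≤ IsLocalRing.maximalIdeal S ^ d) (hxI : ∀ k, x k ^ (d + 2) ∈ I) :
    ∃ (s : ℕ) (P₀ P₁ : Fin s → MvPolynomial (Fin n) κ₀) (G : Fin s → S),
      (∀ l, P₀ l ∈ MvPolynomial.homogeneousSubmodule (Fin n) κ₀ d) ∧
      (∀ l, P₁ l ∈ MvPolynomial.homogeneousSubmodule (Fin n) κ₀ (d + 1)) ∧
      (∀ l, G l ∈ IsLocalRing.maximalIdeal S ^ (d + 2)) ∧
      I = Ideal.span (Set.range fun l =>
            MvPolynomial.eval₂Hom σ x (P₀ l) + MvPolynomial.eval₂Hom σ x (P₁ l) + G l) ⊔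
          Ideal.span (Set.range fun k => x k ^ (d + 2)) := by
  obtain ⟨s, f, hf⟩ := Submodule.fg_iff_exists_fin_generating_family.mp (IsNoetherian.noetherian I)
  have hf' : Ideal.span (Set.range f) = I := hf
  have hfI : ∀ l, f l ∈ I := fun l => hf ▸ Ideal.subset_span ⟨l, rfl⟩
  choose P₀ P₁ hP₀ hP₁ hrem using fun l => exists_forms_sub_mem_pow_add_two σ hσ x hx (hI (hfI l))
  refine ⟨s, P₀, P₁, fun l => f l - MvPolynomial.eval₂Hom σ x (P₀ l) - MvPolynomial.eval₂Hom σ x (P₁ l),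
    hP₀, hP₁, hrem, ?_⟩
  have hgen : (fun l => MvPolynomial.eval₂Hom σ x (P₀ l) + MvPolynomial.eval₂Hom σ x (P₁ l) +
      (f l - MvPolynomial.eval₂Hom σ x (P₀ l) - MvPolynomial.eval₂Hom σ x (P₁ l))) = f := by
    funext l; ring
  rw [hgen, hf']
  exact (sup_eq_left.mpr (Ideal.span_le.mpr (by rintro _ ⟨k, rfl⟩; exact hxI k))).symm

end DepthTargets

end Summit.ResolutionOfSingularities.ResolutionOfSingularities.Theorems

end
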